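import Summits.AtomisticToContinuum.HydrodynamicLimit.Theorems.RelayRaceLocalityNearConstantShortTimeHLTiltL2Defs
import Summits.AtomisticToContinuum.HydrodynamicLimit.Theorems.CollisionIsometryCLTMesoscopicLLNTreeBound
import HarnessLib

/-!
# Crux `NearConstantShortTimeHL` (stmt-AtomisticToContinuum-12502), line `small-tilt-domination`:
# the same-block two-point remainder with the `L²` norm at the roots (`SameBlockL2`)

The two-point function `E[g(x₀) g(x₁) 𝟙[hard core]]` of the canonical hard-sphere gas on `𝕋³`
splits (`integral_two_point_eq`) into cluster terms and the same-block remainder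
`sameBlockRem P ε n h2 g g = Σ_{B ∋ 0, 1} (∫ g(x₀) g(x₁) u_B dμ^{⊗n}) Ξ(univ \ B)`. The tree bounds
it with two sup norms (`abs_sameBlockRem_le`) or with `L¹ × sup` (`LGFS.abs_sameBlockRem_le_L1`);
the `L²` variance bound of the line (`VarianceL2`) needs the same estimate with `C C' ↦ ∫ g² dμ`:

* `tlb_abs_integral_mul_mul_uR_le_sq` (abstract hard-core gas): for `i, j ∈ B`,
  `|∫ g(x_i) g(x_j) u_B| ≤ (∫ g² dν) t(#B) p^{#B-1}` — AM–GM `|g(x_i) g(x_j)| ≤ (g(x_i)² + g(x_j)²)/2`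
  and the integrated tree-graph inequality with the weight `g²` at the root `i`, resp. `j`
  (`MesoLLN.integral_abs_mul_abs_uR_le`, the real form of `lintegral_mul_aU_le`);
* `tl_sameBlockL2 : SameBlockL2` — summing over the blocks by size (`sum_filter_mem_mem_card`),
  exactly as in `abs_sameBlockRem_le`.

No smallness is needed. Reference: Pulvirenti–Tsagkarogiannis, Comm. Math. Phys. 316 (2012) §4
(tree-graph bound).
-/

noncomputable section

namespace Summit.AtomisticToContinuum.HydrodynamicLimit.Theorems.NearConstantShortTimeHL

open MeasureTheory ProbabilityTheory Finset Filter Topology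
open scoped ENNReal BigOperators
open Literature.MathematicalPhysics.KineticTheory Literature.MathematicalPhysics.StatisticalMechanics
  Literature.Probability.LatticeModels

/-! ### Abstract hard-core gas: the two-root `L²` tree bound -/

section Abstract

variable {ι : Type*} [Fintype ι] [DecidableEq ι] {X : Type*} [MeasurableSpace X]
  {O : X → X → Prop} (ν : Measure X) [IsProbabilityMeasure ν]

/-- AM–GM for the two decorations: `|a b u| ≤ (a² |u| + b² |u|) / 2`. [folklore] -/
theorem tlb_abs_mul_mul_le (a b u : ℝ) : |a * b * u| ≤ (a ^ 2 * |u| + b ^ 2 * |u|) / 2 := by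
  rw [abs_mul, abs_mul]
  have h : |a| * |b| ≤ (a ^ 2 + b ^ 2) / 2 := by
    have := two_mul_le_add_sq |a| |b|
    rw [sq_abs, sq_abs] at this
    linarith
  calc |a| * |b| * |u| ≤ (a ^ 2 + b ^ 2) / 2 * |u| := mul_le_mul_of_nonneg_right h (abs_nonneg u)
    _ = (a ^ 2 * |u| + b ^ 2 * |u|) / 2 := by ring

/-- The one-root `L²` piece: `∫ g(x_i)² |u_B| ≤ (∫ g² dν) t(#B) p^{#B-1}` for `i ∈ B` (the weighted
tree-graph inequality with the weight `g²` at the root). [folklore] -/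
theorem tlb_integral_sq_mul_abs_uR_le (hO : MeasurableSet {p : X × X | O p.1 p.2})
    (hOs : ∀ a b, O a b → O b a) {p : ℝ} (hp0 : 0 ≤ p)
    (hp : ∀ z, ν {y | O z y} ≤ ENNReal.ofReal p) {g : X → ℝ} (hg : Measurable g) {C : ℝ}
    (hgC : ∀ y, |g y| ≤ C) {i : ι} {B : Finset ι} (hi : i ∈ B) :
    ∫ x, g (x i) ^ 2 * |uR O x B| ∂Measure.pi (fun _ : ι => ν) ≤
      (∫ y, g y ^ 2 ∂ν) * (treeNumber B.card * p ^ (B.card - 1)) := by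
  have hgC2 : ∀ y, |g y ^ 2| ≤ C ^ 2 := fun y => by
    rw [abs_pow]
    exact pow_le_pow_left₀ (abs_nonneg _) (hgC y) 2
  have h : ∫ x, |g (x i) ^ 2| * |uR O x B| ∂Measure.pi (fun _ : ι => ν) ≤
      (∫ y, |g y ^ 2| ∂ν) * (treeNumber B.card * p ^ (B.card - 1)) :=
    MesoLLN.integral_abs_mul_abs_uR_le ν hO hOs hp0 hp (g := fun y => g y ^ 2) (hg.pow_const 2)
      hgC2 hi
  simp only [abs_pow, sq_abs] at h
  exact h

/-- **Two-root `L²` tree bound**: for `i, j ∈ B` and `g` bounded measurable,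
`|∫ g(x_i) g(x_j) u_B dν^{⊗}| ≤ (∫ g² dν) t(#B) p^{#B-1}`. [folklore] -/
theorem tlb_abs_integral_mul_mul_uR_le_sq (hO : MeasurableSet {p : X × X | O p.1 p.2})
    (hOs : ∀ a b, O a b → O b a) {p : ℝ} (hp0 : 0 ≤ p)
    (hp : ∀ z, ν {y | O z y} ≤ ENNReal.ofReal p) {g : X → ℝ} (hg : Measurable g) {C : ℝ}
    (hgC : ∀ y, |g y| ≤ C) {i j : ι} {B : Finset ι} (hi : i ∈ B) (hj : j ∈ B) :
    |∫ x, g (x i) * g (x j) * uR O x B ∂Measure.pi (fun _ : ι => ν)| ≤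
      (∫ y, g y ^ 2 ∂ν) * (treeNumber B.card * p ^ (B.card - 1)) := by
  set P := Measure.pi (fun _ : ι => ν) with hP
  have y0 : X := (Filter.nonempty_of_neBot (ae ν)).some
  have hC0 : 0 ≤ C := (abs_nonneg _).trans (hgC y0)
  have hsq : ∀ y, g y ^ 2 ≤ C ^ 2 := fun y => by
    rw [← sq_abs]
    exact pow_le_pow_left₀ (abs_nonneg _) (hgC y) 2
  have hgi : Measurable fun x : ι → X => g (x i) := hg.comp (measurable_pi_apply i)
  have hgj : Measurable fun x : ι → X => g (x j) := hg.comp (measurable_pi_apply j)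
  have hint1 : Integrable (fun x : ι → X => |g (x i) * g (x j) * uR O x B|) P :=
    (integrable_pi_of_bounded ν (F := fun x => g (x i) * g (x j) * uR O x B)
      ((hgi.mul hgj).mul (measurable_uR hO B)) (C := C * C * hcUrsellBound B) fun x => by
      rw [abs_mul, abs_mul]
      exact mul_le_mul (mul_le_mul (hgC _) (hgC _) (abs_nonneg _) hC0) (abs_uR_le x B)
        (abs_nonneg _) (mul_nonneg hC0 hC0)).abs
  have hsqi : ∀ k : ι, Integrable (fun x : ι → X => g (x k) ^ 2 * |uR O x B|) P := fun k =>
    integrable_pi_of_bounded ν (F := fun x => g (x k) ^ 2 * |uR O x B|)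
      (((hg.comp (measurable_pi_apply k)).pow_const 2).mul (measurable_uR hO B).abs)
      (C := C ^ 2 * hcUrsellBound B) fun x => by
        rw [abs_mul, abs_abs, abs_of_nonneg (sq_nonneg _)]
        exact mul_le_mul (hsq _) (abs_uR_le x B) (abs_nonneg _) (sq_nonneg C)
  have hint2 : Integrable
      (fun x : ι → X => (g (x i) ^ 2 * |uR O x B| + g (x j) ^ 2 * |uR O x B|) / 2) P :=
    ((hsqi i).add (hsqi j)).div_const 2
  calc |∫ x, g (x i) * g (x j) * uR O x B ∂P|
      ≤ ∫ x, |g (x i) * g (x j) * uR O x B| ∂P :=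
        (Real.norm_eq_abs _).symm.trans_le ((norm_integral_le_integral_norm _).trans_eq
          (integral_congr_ae (ae_of_all _ fun x => Real.norm_eq_abs _)))
    _ ≤ ∫ x, (g (x i) ^ 2 * |uR O x B| + g (x j) ^ 2 * |uR O x B|) / 2 ∂P :=
        integral_mono hint1 hint2 fun x => tlb_abs_mul_mul_le _ _ _
    _ = ((∫ x, g (x i) ^ 2 * |uR O x B| ∂P) + ∫ x, g (x j) ^ 2 * |uR O x B| ∂P) / 2 := by
        rw [integral_div, integral_add (hsqi i) (hsqi j)]
    _ ≤ ((∫ y, g y ^ 2 ∂ν) * (treeNumber B.card * p ^ (B.card - 1)) +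
          (∫ y, g y ^ 2 ∂ν) * (treeNumber B.card * p ^ (B.card - 1))) / 2 := by
        gcongr
        · exact tlb_integral_sq_mul_abs_uR_le ν hO hOs hp0 hp hg hgC hi
        · exact tlb_integral_sq_mul_abs_uR_le ν hO hOs hp0 hp hg hgC hj
    _ = (∫ y, g y ^ 2 ∂ν) * (treeNumber B.card * p ^ (B.card - 1)) := by ring

end Abstract

/-! ### The same-block remainder on `𝕋³` with the `L²(μ)` norm -/

/-- **THE SAME-BLOCK REMAINDER WITH THE `L²` NORM AT THE ROOTS** (no smallness needed): for bounded
measurable `g`, `|same-block terms(g, g)| ≤ (∫ g² dμ) Σ_{j < n-1} C(n-2, j) t(j+2) p_ε^{j+1} Ξ(n-2-j)`,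
the bound `abs_sameBlockRem_le` of the tree with `C C' ↦ ∫ g² dμ`: AM–GM at the two roots and the
integrated tree-graph inequality with the weight `g²` at the root `0`, resp. `1`, then the blocks are
summed by size. [cite: PulvirentiTsagkarogiannis2012, §4] -/
theorem tl_sameBlockL2 : SameBlockL2 := by
  unfold SameBlockL2
  intro P e he he2 n _ h2 g hg C hgC
  set i₁ : Fin n := ⟨1, h2⟩ with hi₁
  have h01 : (0 : Fin n) ≠ i₁ := by simp [hi₁, Fin.ext_iff]
  unfold sameBlockRem
  refine (abs_sum_le_sum_abs _ _).trans ?_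
  have hterm : ∀ B ∈ ((univ : Finset (Fin n)).powerset.filter (fun B => (0 : Fin n) ∈ B)).filter
      (fun B => i₁ ∈ B),
      |(∫ x, g (x 0) * g (x i₁) * uR (Ov e) x B ∂Measure.pi (fun _ : Fin n => P.μ)) *
          hcProb (Ov e) P.μ (univ \ B)| ≤
        (∫ y, g y ^ 2 ∂P.μ) *
          (treeNumber B.card * pOv P e ^ (B.card - 1) * Xi P e n (n - B.card)) := by
    intro B hB
    simp only [mem_filter] at hB
    have hXi : hcProb (Ov e) P.μ (univ \ B) = Xi P e n (n - B.card) := by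
      refine hcProb_eq_of_card_eq P.μ (measurableSet_ov e) ?_
      rw [card_sdiff_of_subset (subset_univ B), card_univ, Fintype.card_fin,
        card_firstLabels (by omega)]
    rw [abs_mul, hXi, abs_of_nonneg (Xi_nonneg _)]
    calc |∫ x, g (x 0) * g (x i₁) * uR (Ov e) x B ∂Measure.pi (fun _ : Fin n => P.μ)| *
          Xi P e n (n - B.card)
        ≤ ((∫ y, g y ^ 2 ∂P.μ) * (treeNumber B.card * pOv P e ^ (B.card - 1))) *
            Xi P e n (n - B.card) :=
          mul_le_mul_of_nonneg_right (tlb_abs_integral_mul_mul_uR_le_sq P.μ (measurableSet_ov e)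
            (ov_symm e) (pOv_nonneg P he) (μ_ov_le_pOv P he he2) hg hgC hB.1.2 hB.2)
            (Xi_nonneg _)
      _ = _ := by ring
  refine (sum_le_sum hterm).trans (le_of_eq ?_)
  rw [sum_filter_mem_mem_card univ (mem_univ 0) (mem_univ i₁) h01
    (fun k => (∫ y, g y ^ 2 ∂P.μ) * (treeNumber k * pOv P e ^ (k - 1) * Xi P e n (n - k))),
    card_univ, Fintype.card_fin, mul_sum]
  refine sum_congr rfl fun j _ => ?_
  rw [nsmul_eq_mul, show j + 2 - 1 = j + 1 by omega, show n - (j + 2) = n - 2 - j by omega]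
  ring

end Summit.AtomisticToContinuum.HydrodynamicLimit.Theorems.NearConstantShortTimeHL

end
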